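import Literature.NumberTheory.Sieve.QuadraticRootsLevelCosets
import Literature.NumberTheory.Sieve.FriedlanderIwaniecPrimesQuadCongr
import Literature.NumberTheory.Sieve.GrimmeltMerikoski2025RootCount
import HarnessLib

/-!
# Uniform bounds for quadratic congruences `αx² + 2βx + γ ≡ 0 (mod n)` and for the level cosets of a form (the level multiplicity in GM 2025 §4.1)

L. Grimmelt, J. Merikoski, *On the greatest prime factor and uniform equidistribution of quadratic
polynomials*, arXiv:2505.00493 [GrimmeltMerikoski2025], §4.1 (proof of Proposition 4.1, the
Heegner-point kernel bound `K₂ ≺≺ Dh^{1/2} + hZ^{1/2}` of §5): both in the diagonal (§4.1.1) and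
the off-diagonal (§4.1.2) the sum over the cosets `τ ∈ T_q = Γ₀(q)∖SL₂(ℤ)` is disposed of by
"`∑_{τ ∈ T_q} α_q(τ z₂) ≪ gcd(𝔞₂, 𝔟₂, 𝔠₂, q) d(q)`", i.e. a bound — UNIFORM in the Heegner point
`z₂` and so in `h ≤ X^{2+o(1)}` — for the number of cosets `τ` with `𝔠(τ z₂) ≡ 0 (mod q)`, where
`𝔠(τ⋄𝔤) = c₀²𝔞 + 2c₀d₀𝔟 + d₀²𝔠` ((3.3)) is the value of the binary form of `z₂` at the bottom row
of `τ`.  In the tree's language (`QuadraticRootsLevelCosets.lean`) these are the *level cosets*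
`RootForms.IsLevelCoset R q` of the form `R`; the tree's count
`RootForms.exists_card_levelCosets_le` (DFI's "`O(τ(q))`") has a constant depending on the form.
This file supplies the uniform version, PROVED:

* `GM2025.quadRootCount α β γ n = #{x mod n : αx² + βx + γ ≡ 0}` with `quadRootCount_mul_le`
  (CRT) and `quadRootCount_mul_left` (`ρ(pα,pβ,pγ; p^{k+1}) = p ρ(α,β,γ; p^k)`);
* local bounds at `p^k` for an even middle coefficient `2β` (`h = αγ − β²`, so that
  `α f = (αx + β)² + h`): `p ∤ α` — at most `4p^{⌊v_p(h)/2⌋}` roots, by the tree's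
  `FriedlanderIwaniecPrimes.card_filter_sq_congr_le` (square roots modulo `p^k`);
  `p ∣ α, p ∤ 2β` — at most one; `p ∣ α, 2β, p ∤ γ` — none; `p = 2 ∣ α, 2 ∤ β` — at most four;
  `p ∣ α, β, γ` — `f = pf'`; assembled by induction on `k` in
  `quadRootCount_prime_pow_le`: `ρ(α, 2β, γ; p^k) ≤ 4 p^{v_p(gcd(α,β,γ)) + ⌊v_p(h)/2⌋}`
  (phrased with `p^{j₁+1} ∤ gcd`, `p^{2j₂+2} ∤ h`);
* `quadRootCount_le_prod`, `quadRootCount_le_of_gcd_of_sq` — for all `n ≥ 1`: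
  `ρ(α, 2β, γ; n) ≤ 4^{ω(n)} · G · E` whenever `gcd(α, β, γ) ∣ G` and `p^{2j} ∣ h ⇒ p^j ∣ E`
  (for `h = a·h₀`, `h₀` square-free, `gcd(a, h₀) = 1`, as in §5 of the paper with determinant
  `ah`, one may take `G = E = 4a`);
* `card_levelCosets_le_sum` — **`#{ξΓ₀(q) : q ∣ (R·ξ).a} ≤ ∑_{e ∣ gcd(A,q)} ρ(A/e, B, Ce; q/e)`**
  for every form `R = [A, B, C]` and `q ≥ 1` (injecting the cosets into the normal-form data
  `(e, u mod q/e)` of `RootForms.exists_levelCoset_rep`); each quadratic `(A/e)u² + Bu + Ce`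
  has discriminant `B² − 4AC`, so for `B = 2𝔟` the previous bound applies with the same `h`.

Everything here is elementary and proved; nothing is vendored.  It is the "level multiplicity"
ingredient of the tree's formalisation of §§4–5 of the paper around the named fact
`grimmeltMerikoski2025_thm14_restricted`.

## References

* [GrimmeltMerikoski2025] arXiv:2505.00493, §4.1.1–4.1.2 (the bound `≪ gcd(𝔞₂,𝔟₂,𝔠₂,q) d(q)`,
  "using the assumption that `gcd(h, q²)` is square-free").
* W. Duke, J. B. Friedlander, H. Iwaniec, Ann. of Math. 141 (1995), §2 p. 428 (the count
  `O(τ(q))` of the `τ` with `γ_τ ≡ 0 (mod q)`). [cite: DukeFriedlanderIwaniec1995, §2 p. 428]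
-/

noncomputable section

namespace Literature.NumberTheory.Sieve

open Finset
open Literature.NumberTheory.QuadraticFields.Quadratic (BinQF)
open scoped MatrixGroups

namespace GM2025

/-! ### The root count of a quadratic congruence -/

/-- `ρ(α, β, γ; n) = #{x mod n : αx² + βx + γ ≡ 0 (mod n)}` (count over `x ∈ {0, …, n-1}`;
junk value `0` at `n = 0`, as `Finset.range 0 = ∅`).  This is the tree's
`Literature.NumberTheory.Sieve.polyRootCountMod` of the single polynomial `αX² + βX + γ`
(`quadRootCount_eq_polyRootCountMod`), written with the coefficients as arguments because the
bounds below are by induction on them (`f = p f'`); in particular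
`GM2025.rho a h k = quadRootCount a 0 h k` (`rho_eq_quadRootCount`). [folklore] -/
def quadRootCount (α β γ : ℤ) (n : ℕ) : ℕ :=
  #((range n).filter fun x : ℕ => (n : ℤ) ∣ α * (x : ℤ) ^ 2 + β * x + γ)

/-- `quadRootCount` is `polyRootCountMod` of the quadratic `αX² + βX + γ`. [folklore] -/
theorem quadRootCount_eq_polyRootCountMod (α β γ : ℤ) (n : ℕ) :
    quadRootCount α β γ n =
      polyRootCountMod ![(Polynomial.C α * Polynomial.X ^ 2 + Polynomial.C β * Polynomial.X +
        Polynomial.C γ : Polynomial ℤ)] n := by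
  simp [quadRootCount, polyRootCountMod]

/-- The root count `ϱ_{a,h}(k)` of `GrimmeltMerikoski2025.lean` is `quadRootCount a 0 h k`.
[folklore] -/
theorem rho_eq_quadRootCount (a h k : ℕ) : rho a h k = quadRootCount a 0 h k := by
  rw [rho_eq_card_filter, quadRootCount]
  congr 1
  refine filter_congr fun ν _ => ?_
  simp

/-- The trivial bound `ρ ≤ n`. [folklore] -/
theorem quadRootCount_le (α β γ : ℤ) (n : ℕ) : quadRootCount α β γ n ≤ n :=
  (card_filter_le _ _).trans (by simp)

/-- `ρ(·; 1) = 1`. [folklore] -/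
theorem quadRootCount_one (α β γ : ℤ) : quadRootCount α β γ 1 = 1 := by
  unfold quadRootCount
  rw [filter_true_of_mem fun x _ => by simp]
  simp

/-- `f(u) − f(u') = (u − u')(α(u + u') + β)` for `f = αX² + βX + γ`. [folklore] -/
theorem quad_sub_quad (α β γ u u' : ℤ) :
    (α * u ^ 2 + β * u + γ) - (α * u' ^ 2 + β * u' + γ) = (u - u') * (α * (u + u') + β) := by ring

/-- `m ∣ u − u'` implies `f(u) ≡ f(u') (mod m)`. [folklore] -/
theorem dvd_quad_iff_of_dvd_sub {m α β γ u u' : ℤ} (h : m ∣ u - u') :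
    m ∣ α * u ^ 2 + β * u + γ ↔ m ∣ α * u' ^ 2 + β * u' + γ := by
  have hd : m ∣ (α * u ^ 2 + β * u + γ) - (α * u' ^ 2 + β * u' + γ) := by
    rw [quad_sub_quad]; exact h.mul_right _
  constructor
  · intro h1; have := dvd_sub h1 hd; rwa [sub_sub_cancel] at this
  · intro h1; have := dvd_add h1 hd; rwa [add_sub_cancel] at this

/-- Scaling all coefficients and the modulus by `p`:
`ρ(pα, pβ, pγ; p^{k+1}) = p · ρ(α, β, γ; p^k)`. [folklore] -/
theorem quadRootCount_mul_left (p : ℕ) (hp : 0 < p) (α β γ : ℤ) (k : ℕ) :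
    quadRootCount (p * α) (p * β) (p * γ) (p ^ (k + 1)) = p * quadRootCount α β γ (p ^ k) := by
  unfold quadRootCount
  have hP : ∀ x : ℕ, ((p ^ (k + 1) : ℕ) : ℤ) ∣ (p : ℤ) * α * (x : ℤ) ^ 2 + (p : ℤ) * β * x + p * γ ↔
      ((p ^ k : ℕ) : ℤ) ∣ α * (x : ℤ) ^ 2 + β * x + γ := by
    intro x
    rw [show (p : ℤ) * α * (x : ℤ) ^ 2 + (p : ℤ) * β * x + p * γ =
      (p : ℤ) * (α * (x : ℤ) ^ 2 + β * x + γ) by ring]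
    push_cast
    rw [pow_succ, mul_comm ((p : ℤ) ^ k) (p : ℤ)]
    exact Int.mul_dvd_mul_iff_left (by exact_mod_cast hp.ne')
  have hP' : ∀ x : ℕ, ((p ^ k : ℕ) : ℤ) ∣ α * ((x + p ^ k : ℕ) : ℤ) ^ 2 + β * ((x + p ^ k : ℕ) : ℤ) + γ ↔
      ((p ^ k : ℕ) : ℤ) ∣ α * (x : ℤ) ^ 2 + β * x + γ := by
    intro x
    refine dvd_quad_iff_of_dvd_sub ⟨1, ?_⟩
    push_cast; ring
  rw [filter_congr fun x _ => hP x, pow_succ,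
    FriedlanderIwaniecPrimes.card_filter_range_mul (p ^ k) p _ hP']

/-- **Sub-multiplicativity in the modulus** (Chinese remainder theorem): for coprime `m, n`,
`ρ(mn) ≤ ρ(m) ρ(n)`. [folklore] -/
theorem quadRootCount_mul_le {m n : ℕ} (hm : 0 < m) (hn : 0 < n) (hmn : m.Coprime n)
    (α β γ : ℤ) :
    quadRootCount α β γ (m * n) ≤ quadRootCount α β γ m * quadRootCount α β γ n := by
  unfold quadRootCount
  rw [← card_product]
  refine card_le_card_of_injOn (fun x => (x % m, x % n)) (fun x hx => ?_) ?_
  · rw [mem_coe, mem_filter, mem_range] at hx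
    obtain ⟨_, hdvd⟩ := hx
    have hxm : (m : ℤ) ∣ (x : ℤ) - ((x % m : ℕ) : ℤ) := by
      rw [Int.natCast_mod]; exact ⟨(x : ℤ) / m, by rw [Int.emod_def]; ring⟩
    have hxn : (n : ℤ) ∣ (x : ℤ) - ((x % n : ℕ) : ℤ) := by
      rw [Int.natCast_mod]; exact ⟨(x : ℤ) / n, by rw [Int.emod_def]; ring⟩
    rw [mem_coe, mem_product, mem_filter, mem_filter, mem_range, mem_range]
    refine ⟨⟨Nat.mod_lt _ hm, ?_⟩, Nat.mod_lt _ hn, ?_⟩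
    · rw [← dvd_quad_iff_of_dvd_sub hxm]
      exact (Int.natCast_dvd_natCast.mpr (dvd_mul_right m n)).trans (by exact_mod_cast hdvd)
    · rw [← dvd_quad_iff_of_dvd_sub hxn]
      exact (Int.natCast_dvd_natCast.mpr (dvd_mul_left n m)).trans (by exact_mod_cast hdvd)
  · intro x hx x' hx' hxx'
    rw [mem_coe, mem_filter, mem_range] at hx hx'
    simp only [Prod.mk.injEq] at hxx'
    have e1 : x ≡ x' [MOD m] := hxx'.1
    have e2 : x ≡ x' [MOD n] := hxx'.2
    exact Nat.ModEq.eq_of_lt_of_lt ((Nat.modEq_and_modEq_iff_modEq_mul hmn).mp ⟨e1, e2⟩) hx.1 hx'.1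

/-! ### Local bounds at a prime power (even middle coefficient `2β`) -/

section localBounds

variable {p : ℕ} (hp : p.Prime)
include hp

/-- `¬ p ∣ 1` over `ℤ`. [folklore] -/
theorem not_intCast_dvd_one : ¬ (p : ℤ) ∣ 1 := by
  intro h1
  have : p ∣ 1 := by exact_mod_cast h1
  exact hp.one_lt.ne' (Nat.dvd_one.mp this)

/-- **Case `p ∤ α`.**  Completing the square, `α(αx² + 2βx + γ) = (αx + β)² + (αγ − β²)`, the
roots modulo `p^k` inject (`x ↦ αx + β`, `α` a unit) into the square roots of `−(αγ − β²)`,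
of which there are at most `4p^{⌊v/2⌋}`, `v = v_p(αγ − β²) ∧ k`
(`FriedlanderIwaniecPrimes.card_filter_sq_congr_le`).  In the form used below: if
`p^{2j+2} ∤ αγ − β²` then `ρ(α, 2β, γ; p^k) ≤ 4p^j`. [folklore] -/
theorem quadRootCount_prime_pow_le_of_not_dvd {α β γ : ℤ} (hα : ¬ (p : ℤ) ∣ α)
    (hh : α * γ - β ^ 2 ≠ 0) {j : ℕ} (hj : ¬ (p : ℤ) ^ (2 * j + 2) ∣ α * γ - β ^ 2) (k : ℕ) :
    quadRootCount α (2 * β) γ (p ^ k) ≤ 4 * p ^ j := by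
  haveI := Fact.mk hp
  set h : ℤ := α * γ - β ^ 2 with hhdef
  set v : ℕ := padicValNat p h.natAbs with hv
  have hhn : h.natAbs ≠ 0 := Int.natAbs_ne_zero.mpr hh
  have hvj : v ≤ 2 * j + 1 := by
    by_contra hcon
    have h1 : p ^ (2 * j + 2) ∣ h.natAbs := (padicValNat_dvd_iff_le hhn).mpr (by omega)
    exact hj (Int.natCast_dvd.mpr (by exact_mod_cast h1))
  set e : ℕ := min v k with he
  have hek : e ≤ k := min_le_right _ _
  have hpe : (p : ℤ) ^ e ∣ -h := by
    rw [dvd_neg]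
    have h1 : p ^ e ∣ h.natAbs := (pow_dvd_pow p (min_le_left _ _)).trans pow_padicValNat_dvd
    exact Int.natCast_dvd.mpr (by exact_mod_cast h1)
  have hmax : e = k ∨ ¬ (p : ℤ) ^ (e + 1) ∣ -h := by
    rcases le_or_gt k v with hkv | hkv
    · left; rw [he, min_eq_right hkv]
    · right
      rw [he, min_eq_left hkv.le, dvd_neg]
      intro hcon
      have h1 : p ^ (v + 1) ∣ h.natAbs := by
        have := Int.natCast_dvd.mp hcon
        exact_mod_cast this
      exact pow_succ_padicValNat_not_dvd hhn h1
  have hbound := FriedlanderIwaniecPrimes.card_filter_sq_congr_le hp hek (a := 1) (m := -h)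
    (not_intCast_dvd_one hp) hpe hmax
  -- the injection `x ↦ (αx + β) mod p^k`
  set q : ℕ := p ^ k with hq
  have hq0 : 0 < q := pow_pos hp.pos k
  have hqZ : (0 : ℤ) < (q : ℤ) := by exact_mod_cast hq0
  set T := (range q).filter (fun x : ℕ => (p : ℤ) ^ k ∣ 1 * (x : ℤ) ^ 2 - -h) with hT
  have hmap : ∀ x ∈ (range q).filter (fun x : ℕ => (q : ℤ) ∣ α * (x : ℤ) ^ 2 + 2 * β * x + γ),
      (((α * x + β) % q).toNat) ∈ T := by
    intro x hx
    rw [mem_filter, mem_range] at hx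
    set t : ℤ := α * x + β with ht
    have ht0 : 0 ≤ t % q := Int.emod_nonneg _ hqZ.ne'
    have htq : t % q < q := Int.emod_lt_of_pos _ hqZ
    have hcast : (((t % q).toNat : ℕ) : ℤ) = t % q := Int.toNat_of_nonneg ht0
    rw [hT, mem_filter, mem_range]
    refine ⟨by zify; rw [hcast]; exact htq, ?_⟩
    rw [hcast, one_mul, sub_neg_eq_add]
    have hqt : (q : ℤ) ∣ t % q - t := by
      rw [Int.emod_def]; exact ⟨-(t / q), by ring⟩
    have hkey : (q : ℤ) ∣ t ^ 2 + h := by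
      have : t ^ 2 + h = α * (α * (x : ℤ) ^ 2 + 2 * β * x + γ) := by rw [ht, hhdef]; ring
      rw [this]; exact hx.2.mul_left _
    have hdiff : (q : ℤ) ∣ (t % q) ^ 2 + h - (t ^ 2 + h) := by
      rw [show (t % q) ^ 2 + h - (t ^ 2 + h) = (t % q - t) * (t % q + t) by ring]
      exact hqt.mul_right _
    have := dvd_add hkey hdiff
    rw [add_sub_cancel] at this
    rw [hq] at this
    exact_mod_cast this
  have hinj : Set.InjOn (fun x : ℕ => ((α * x + β) % q).toNat)
      ↑((range q).filter (fun x : ℕ => (q : ℤ) ∣ α * (x : ℤ) ^ 2 + 2 * β * x + γ)) := by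
    intro x hx x' hx' hxx'
    rw [mem_coe, mem_filter, mem_range] at hx hx'
    simp only at hxx'
    have h0 : ∀ y : ℕ, 0 ≤ (α * y + β) % q := fun y => Int.emod_nonneg _ hqZ.ne'
    have e1 : (α * x + β) % q = (α * x' + β) % q := by
      have := congrArg (fun n : ℕ => (n : ℤ)) hxx'
      simpa only [Int.toNat_of_nonneg (h0 x), Int.toNat_of_nonneg (h0 x')] using this
    have e2 : (q : ℤ) ∣ α * ((x : ℤ) - x') := by
      rw [show α * ((x : ℤ) - x') = (α * x + β) - (α * x' + β) by ring]
      exact Int.ModEq.dvd e1.symm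
    have hcop : IsCoprime ((q : ℤ)) α := by
      rw [hq]; push_cast
      exact IsCoprime.pow_left ((Int.prime_iff_natAbs_prime.mpr (by simpa using hp)).coprime_iff_not_dvd.mpr hα)
    have e3 : (q : ℤ) ∣ (x : ℤ) - x' := hcop.dvd_of_dvd_mul_left e2
    have hlt : |(x : ℤ) - x'| < (q : ℤ) := by
      rw [abs_sub_lt_iff]
      constructor <;>
        linarith [(show (0:ℤ) ≤ x from by positivity), (show (0:ℤ) ≤ x' from by positivity),
          (show ((x:ℤ)) < q from by exact_mod_cast hx.1), (show ((x':ℤ)) < q from by exact_mod_cast hx'.1)]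
    exact_mod_cast Int.eq_of_sub_eq_zero (Int.eq_zero_of_abs_lt_dvd e3 hlt)
  calc quadRootCount α (2 * β) γ (p ^ k)
      = #((range q).filter (fun x : ℕ => (q : ℤ) ∣ α * (x : ℤ) ^ 2 + 2 * β * x + γ)) := by
        rw [quadRootCount, hq]
    _ ≤ #T := card_le_card_of_injOn _ hmap hinj
    _ ≤ 4 * p ^ (e / 2) := hbound
    _ ≤ 4 * p ^ j := by
        refine Nat.mul_le_mul_left 4 (Nat.pow_le_pow_right hp.pos ?_)
        have : e ≤ v := min_le_left _ _
        omega

/-- **Case `p ∣ α`, `p ∤ 2β`.**  Two roots `x, x'` give `p^k ∣ (x − x')(α(x + x') + 2β)` with the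
second factor `≡ 2β ≢ 0 (mod p)`, so `x = x'`: at most one root. [folklore] -/
theorem quadRootCount_le_one_of_dvd_of_not_dvd {α β γ : ℤ} (hα : (p : ℤ) ∣ α)
    (hβ : ¬ (p : ℤ) ∣ 2 * β) (k : ℕ) : quadRootCount α (2 * β) γ (p ^ k) ≤ 1 := by
  unfold quadRootCount
  refine card_le_one.mpr fun x hx x' hx' => ?_
  rw [mem_filter, mem_range] at hx hx'
  have hpI : Prime (p : ℤ) := Nat.prime_iff_prime_int.mp hp
  have hdiff : ((p ^ k : ℕ) : ℤ) ∣ ((x : ℤ) - x') * (α * (x + x') + 2 * β) := by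
    rw [← quad_sub_quad]; exact dvd_sub hx.2 hx'.2
  have hunit : ¬ (p : ℤ) ∣ α * ((x : ℤ) + x') + 2 * β := by
    intro hcon
    exact hβ (by simpa using dvd_sub hcon (hα.mul_right ((x : ℤ) + x')))
  have hcop : IsCoprime (((p ^ k : ℕ) : ℤ)) (α * ((x : ℤ) + x') + 2 * β) := by
    push_cast
    exact IsCoprime.pow_left (hpI.coprime_iff_not_dvd.mpr hunit)
  have e3 : ((p ^ k : ℕ) : ℤ) ∣ (x : ℤ) - x' := hcop.dvd_of_dvd_mul_right hdiff
  have hlt : |(x : ℤ) - x'| < (p ^ k : ℕ) := by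
    rw [abs_sub_lt_iff]
    constructor <;> [skip; skip] <;>
      linarith [(show (0:ℤ) ≤ x from by positivity), (show (0:ℤ) ≤ x' from by positivity),
        (show ((x:ℤ)) < (p ^ k : ℕ) from by exact_mod_cast hx.1),
        (show ((x':ℤ)) < (p ^ k : ℕ) from by exact_mod_cast hx'.1)]
  exact_mod_cast Int.eq_of_sub_eq_zero (Int.eq_zero_of_abs_lt_dvd e3 hlt)

omit hp in
/-- **Case `p ∣ α`, `p ∣ 2β`, `p ∤ γ`** (`k ≥ 1`): `f(x) ≡ γ ≢ 0 (mod p)`, no roots. [folklore] -/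
theorem quadRootCount_eq_zero_of_dvd_of_dvd {α β γ : ℤ} (hα : (p : ℤ) ∣ α) (hβ : (p : ℤ) ∣ 2 * β)
    (hγ : ¬ (p : ℤ) ∣ γ) {k : ℕ} (hk : 0 < k) : quadRootCount α (2 * β) γ (p ^ k) = 0 := by
  unfold quadRootCount
  rw [card_eq_zero, filter_eq_empty_iff]
  intro x _ hdvd
  have h1 : (p : ℤ) ∣ α * (x : ℤ) ^ 2 + 2 * β * x + γ :=
    (dvd_pow_self (p : ℤ) hk.ne').trans (by exact_mod_cast hdvd)
  have h2 : (p : ℤ) ∣ α * (x : ℤ) ^ 2 + 2 * β * x := dvd_add (hα.mul_right _) (hβ.mul_right _)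
  exact hγ (by simpa using dvd_sub h1 h2)

/-- **Case `p = 2`, `α, γ` even, `β` odd.**  Two roots of the same parity are congruent modulo
`2^{k-1}` (`f(x) − f(x') = (x − x') · 2(α'(x+x') + β)` with the last factor odd), so there are at
most two roots in each parity class: `ρ ≤ 4`. [folklore] -/
theorem quadRootCount_le_four_of_two (hp2 : p = 2) {α β γ : ℤ} (hα : (2 : ℤ) ∣ α)
    (hβ : ¬ (2 : ℤ) ∣ β) (k : ℕ) : quadRootCount α (2 * β) γ (p ^ k) ≤ 4 := by
  subst hp2
  rcases Nat.eq_zero_or_pos k with rfl | hk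
  · rw [pow_zero, quadRootCount_one]; norm_num
  obtain ⟨d, rfl⟩ : ∃ d, k = d + 1 := ⟨k - 1, by omega⟩
  unfold quadRootCount
  set S := (range (2 ^ (d + 1))).filter
    (fun x : ℕ => ((2 ^ (d + 1) : ℕ) : ℤ) ∣ α * (x : ℤ) ^ 2 + 2 * β * x + γ) with hS
  obtain ⟨α', rfl⟩ := hα
  -- the map `x ↦ (x % 2, x / 2^d)` is injective on `S`
  have hkey : ∀ x ∈ S, ∀ x' ∈ S, x % 2 = x' % 2 → (2 ^ d : ℤ) ∣ (x : ℤ) - x' := by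
    intro x hx x' hx' hpar
    rw [hS, mem_filter] at hx hx'
    have hdiff : ((2 ^ (d + 1) : ℕ) : ℤ) ∣ ((x : ℤ) - x') * (2 * α' * (x + x') + 2 * β) := by
      rw [← quad_sub_quad]; exact dvd_sub hx.2 hx'.2
    rw [show ((x : ℤ) - x') * (2 * α' * (x + x') + 2 * β) = 2 * (((x : ℤ) - x') * (α' * (x + x') + β))
      by ring] at hdiff
    push_cast at hdiff
    rw [pow_succ, mul_comm ((2:ℤ) ^ d) 2] at hdiff
    have hdiff' : (2 : ℤ) ^ d ∣ ((x : ℤ) - x') * (α' * (x + x') + β) :=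
      (Int.mul_dvd_mul_iff_left two_ne_zero).mp hdiff
    -- the cofactor is odd
    have heven : (2 : ℤ) ∣ (x : ℤ) + x' := by
      have : (x + x') % 2 = 0 := by omega
      exact_mod_cast (Nat.dvd_of_mod_eq_zero this)
    have hodd : ¬ (2 : ℤ) ∣ α' * ((x : ℤ) + x') + β := by
      intro hcon
      exact hβ (by simpa using dvd_sub hcon (heven.mul_left α'))
    have hcop : IsCoprime ((2 : ℤ) ^ d) (α' * ((x : ℤ) + x') + β) :=
      IsCoprime.pow_left (Int.prime_two.coprime_iff_not_dvd.mpr hodd)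
    exact hcop.dvd_of_dvd_mul_right hdiff'
  have hinj : Set.InjOn (fun x : ℕ => (x % 2, x / 2 ^ d)) ↑S := by
    intro x hx x' hx' hxx'
    simp only [Prod.mk.injEq] at hxx'
    have h1 := hkey x hx x' hx' hxx'.1
    -- `|x - x'| < 2^d` from equal quotients
    have q1 : (x : ℤ) = (2 : ℤ) ^ d * ((x / 2 ^ d : ℕ) : ℤ) + ((x % 2 ^ d : ℕ) : ℤ) := by
      exact_mod_cast (Nat.div_add_mod x (2 ^ d)).symm
    have q2 : (x' : ℤ) = (2 : ℤ) ^ d * ((x' / 2 ^ d : ℕ) : ℤ) + ((x' % 2 ^ d : ℕ) : ℤ) := by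
      exact_mod_cast (Nat.div_add_mod x' (2 ^ d)).symm
    have r1 : ((x % 2 ^ d : ℕ) : ℤ) < (2 : ℤ) ^ d := by exact_mod_cast Nat.mod_lt x (Nat.two_pow_pos d)
    have r2 : ((x' % 2 ^ d : ℕ) : ℤ) < (2 : ℤ) ^ d := by exact_mod_cast Nat.mod_lt x' (Nat.two_pow_pos d)
    have r1' : (0 : ℤ) ≤ ((x % 2 ^ d : ℕ) : ℤ) := by positivity
    have r2' : (0 : ℤ) ≤ ((x' % 2 ^ d : ℕ) : ℤ) := by positivity
    have hqq : ((x / 2 ^ d : ℕ) : ℤ) = ((x' / 2 ^ d : ℕ) : ℤ) := by rw [hxx'.2]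
    have hlt : |(x : ℤ) - x'| < (2 : ℤ) ^ d := by
      rw [abs_sub_lt_iff]
      constructor <;> nlinarith [q1, q2, r1, r2, r1', r2', hqq]
    exact_mod_cast Int.eq_of_sub_eq_zero (Int.eq_zero_of_abs_lt_dvd h1 hlt)
  have hmaps : ∀ x ∈ S, (x % 2, x / 2 ^ d) ∈ (range 2) ×ˢ (range 2) := by
    intro x hx
    rw [hS, mem_filter, mem_range] at hx
    rw [mem_product, mem_range, mem_range]
    refine ⟨Nat.mod_lt _ two_pos, ?_⟩
    rw [Nat.div_lt_iff_lt_mul (Nat.two_pow_pos d)]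
    rw [pow_succ] at hx
    linarith [hx.1]
  calc #S ≤ #((range 2) ×ˢ (range 2)) := card_le_card_of_injOn _ hmaps hinj
    _ = 4 := by simp

/-- **The local bound.**  For `h = αγ − β² ≠ 0`, `g = gcd(α, β, γ)`, every prime `p` and all
`k, j₁, j₂` with `p^{j₁+1} ∤ g` and `p^{2j₂+2} ∤ h`:  `ρ(α, 2β, γ; p^k) ≤ 4 p^{j₁ + j₂}`
(so `ρ(p^k) ≤ 4 p^{v_p(g) + ⌊v_p(h)/2⌋}`).  By induction on `k` through the four cases
`p ∤ α` / `p ∣ α, p ∤ 2β` / `p ∣ α, 2β, p ∤ γ` / `p ∣ α, 2β, γ` (where either `p ∣ β` and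
`f = p f'`, `h = p² h'`, `g = p g'`, or `p = 2 ∤ β`). [folklore] -/
theorem quadRootCount_prime_pow_le :
    ∀ (k j₁ j₂ : ℕ) (α β γ : ℤ), α * γ - β ^ 2 ≠ 0 →
      ¬ (p : ℤ) ^ (j₁ + 1) ∣ (Int.gcd (Int.gcd α β) γ : ℤ) →
      ¬ (p : ℤ) ^ (2 * j₂ + 2) ∣ α * γ - β ^ 2 →
      quadRootCount α (2 * β) γ (p ^ k) ≤ 4 * p ^ (j₁ + j₂) := by
  have hpI : Prime (p : ℤ) := Nat.prime_iff_prime_int.mp hp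
  have hp0 : (p : ℤ) ≠ 0 := by exact_mod_cast hp.ne_zero
  intro k
  induction k with
  | zero =>
    intro j₁ j₂ α β γ _ _ _
    rw [pow_zero, quadRootCount_one]
    have : 1 ≤ p ^ (j₁ + j₂) := Nat.one_le_pow _ _ hp.pos
    omega
  | succ k ih =>
    intro j₁ j₂ α β γ hh hg hj
    have hpow : 1 ≤ p ^ (j₁ + j₂) := Nat.one_le_pow _ _ hp.pos
    by_cases hα : (p : ℤ) ∣ α
    · by_cases h2β : (p : ℤ) ∣ 2 * β
      · by_cases hγ : (p : ℤ) ∣ γ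
        · by_cases hβ : (p : ℤ) ∣ β
          · -- recursion: `f = p f'`
            obtain ⟨α', rfl⟩ := hα
            obtain ⟨β', rfl⟩ := hβ
            obtain ⟨γ', rfl⟩ := hγ
            have hh' : α' * γ' - β' ^ 2 ≠ 0 := by
              intro h0; apply hh
              rw [show (p : ℤ) * α' * (p * γ') - (p * β') ^ 2 = p ^ 2 * (α' * γ' - β' ^ 2) by ring, h0,
                mul_zero]
            -- `j₁ ≥ 1`, `j₂ ≥ 1`
            have hgcd : (Int.gcd (Int.gcd ((p : ℤ) * α') (p * β')) (p * γ') : ℤ) =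
                p * (Int.gcd (Int.gcd α' β') γ' : ℤ) := by
              rw [Int.gcd_mul_left, Int.natAbs_natCast]
              push_cast
              rw [Int.gcd_mul_left, Int.natAbs_natCast]
              push_cast
              ring
            have hj₁ : 1 ≤ j₁ := by
              by_contra h0
              have : j₁ = 0 := by omega
              subst this
              apply hg
              rw [hgcd, zero_add, pow_one]
              exact dvd_mul_right _ _
            have hj₂ : 1 ≤ j₂ := by
              by_contra h0
              have : j₂ = 0 := by omega
              subst this
              apply hj
              rw [show (p : ℤ) * α' * (p * γ') - (p * β') ^ 2 = p ^ 2 * (α' * γ' - β' ^ 2) by ring]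
              exact dvd_mul_right _ _
            obtain ⟨i₁, rfl⟩ : ∃ i, j₁ = i + 1 := ⟨j₁ - 1, by omega⟩
            obtain ⟨i₂, rfl⟩ : ∃ i, j₂ = i + 1 := ⟨j₂ - 1, by omega⟩
            have hg' : ¬ (p : ℤ) ^ (i₁ + 1) ∣ (Int.gcd (Int.gcd α' β') γ' : ℤ) := by
              intro hcon; apply hg
              rw [hgcd, pow_succ, mul_comm _ (p : ℤ)]
              exact mul_dvd_mul_left _ hcon
            have hj' : ¬ (p : ℤ) ^ (2 * i₂ + 2) ∣ α' * γ' - β' ^ 2 := by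
              intro hcon; apply hj
              rw [show (p : ℤ) * α' * (p * γ') - (p * β') ^ 2 = p ^ 2 * (α' * γ' - β' ^ 2) by ring,
                show 2 * (i₂ + 1) + 2 = 2 + (2 * i₂ + 2) by ring, pow_add]
              exact mul_dvd_mul_left _ hcon
            have hrec := ih i₁ i₂ α' β' γ' hh' hg' hj'
            rw [show (2 : ℤ) * (p * β') = p * (2 * β') by ring,
              quadRootCount_mul_left p hp.pos α' (2 * β') γ' k]
            calc p * quadRootCount α' (2 * β') γ' (p ^ k) ≤ p * (4 * p ^ (i₁ + i₂)) :=
                  Nat.mul_le_mul_left p hrec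
              _ = 4 * p ^ (i₁ + i₂ + 1) := by ring
              _ ≤ 4 * p ^ (i₁ + 1 + (i₂ + 1)) :=
                  Nat.mul_le_mul_left 4 (Nat.pow_le_pow_right hp.pos (by omega))
          · -- `p ∣ 2β`, `p ∤ β`: `p = 2`
            have hp2 : p = 2 := by
              rcases hpI.dvd_or_dvd h2β with h2 | h2
              · have : (p : ℤ) ∣ ((2 : ℕ) : ℤ) := by exact_mod_cast h2
                have := Int.natCast_dvd_natCast.mp this
                exact (Nat.prime_dvd_prime_iff_eq hp Nat.prime_two).mp this
              · exact absurd h2 hβ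
            subst hp2
            have hα2 : (2 : ℤ) ∣ α := by exact_mod_cast hα
            have hβ2 : ¬ (2 : ℤ) ∣ β := by exact_mod_cast hβ
            exact (quadRootCount_le_four_of_two hp rfl hα2 hβ2 (k + 1)).trans (by omega)
        · rw [quadRootCount_eq_zero_of_dvd_of_dvd hα h2β hγ (Nat.succ_pos k)]
          exact Nat.zero_le _
      · exact (quadRootCount_le_one_of_dvd_of_not_dvd hp hα h2β (k + 1)).trans (by omega)
    · calc quadRootCount α (2 * β) γ (p ^ (k + 1)) ≤ 4 * p ^ j₂ :=
            quadRootCount_prime_pow_le_of_not_dvd hp hα hh hj (k + 1)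
        _ ≤ 4 * p ^ (j₁ + j₂) := Nat.mul_le_mul_left 4 (Nat.pow_le_pow_right hp.pos (by omega))

end localBounds

/-! ### All moduli -/

/-- `∏_{p ∈ S} p^{v_p(G)} ∣ G` for a finite set of primes `S` and `G ≠ 0`. [folklore] -/
theorem prod_pow_padicValNat_dvd (G : ℕ) (S : Finset ℕ) (hS : ∀ p ∈ S, p.Prime) :
    (∏ p ∈ S, p ^ padicValNat p G) ∣ G := by
  classical
  induction S using Finset.induction_on with
  | empty => simp
  | insert p S hpS ih =>
    rw [prod_insert hpS]
    have hp : p.Prime := hS p (mem_insert_self _ _)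
    have hS' : ∀ r ∈ S, r.Prime := fun r hr => hS r (mem_insert_of_mem hr)
    have h1 : p ^ padicValNat p G ∣ G := pow_padicValNat_dvd
    have hcop : (p ^ padicValNat p G).Coprime (∏ r ∈ S, r ^ padicValNat r G) := by
      refine Nat.Coprime.prod_right fun r hr => ?_
      have hne : p ≠ r := fun h => hpS (h ▸ hr)
      exact ((Nat.coprime_primes hp (hS' r hr)).mpr hne).pow _ _
    exact hcop.mul_dvd_of_dvd_of_dvd h1 (ih hS')

/-- **The uniform bound for all moduli.**  Let `h = αγ − β² ≠ 0`, `g = gcd(α, β, γ)`, and let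
`G, E ≥ 1` with `g ∣ G` and `p^{2j} ∣ h ⇒ p^j ∣ E` for all primes `p`.  Then for every `n ≥ 1`,
`ρ(α, 2β, γ; n) ≤ 4^{ω(n)} ∏_{p ∣ n} p^{v_p(G) + v_p(E)} ≤ 4^{ω(n)} · G · E`
(multiplicativity over coprime moduli and the local bound `quadRootCount_prime_pow_le`). [folklore] -/
theorem quadRootCount_le_prod {α β γ : ℤ} (hh : α * γ - β ^ 2 ≠ 0) {G E : ℕ} (hG0 : G ≠ 0)
    (hE0 : E ≠ 0) (hG : (Int.gcd (Int.gcd α β) γ : ℤ) ∣ (G : ℤ))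
    (hE : ∀ (p j : ℕ), p.Prime → (p : ℤ) ^ (2 * j) ∣ α * γ - β ^ 2 → p ^ j ∣ E) :
    ∀ n : ℕ, 0 < n → quadRootCount α (2 * β) γ n ≤
      4 ^ n.primeFactors.card * ∏ p ∈ n.primeFactors, p ^ (padicValNat p G + padicValNat p E) := by
  intro n hn
  induction n using Nat.recOnPosPrimePosCoprime with
  | zero => exact absurd hn (lt_irrefl 0)
  | one => simp [quadRootCount_one]
  | prime_pow p k hp hk =>
    haveI := Fact.mk hp
    rw [Nat.primeFactors_prime_pow hk.ne' hp, card_singleton, prod_singleton, pow_one]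
    refine quadRootCount_prime_pow_le hp k _ _ α β γ hh ?_ ?_
    · intro hcon
      have h1 : (p : ℤ) ^ (padicValNat p G + 1) ∣ (G : ℤ) := hcon.trans hG
      have h2 : p ^ (padicValNat p G + 1) ∣ G := by exact_mod_cast h1
      exact pow_succ_padicValNat_not_dvd hG0 h2
    · intro hcon
      have h1 := hE p (padicValNat p E + 1) hp
        (by rw [show 2 * (padicValNat p E + 1) = 2 * padicValNat p E + 2 by ring]; exact hcon)
      exact pow_succ_padicValNat_not_dvd hE0 h1
  | coprime m n hm hn' hmn ihm ihn =>
    have hm0 : 0 < m := by omega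
    have hn0 : 0 < n := by omega
    have h1 := ihm hm0
    have h2 := ihn hn0
    have hdisj : Disjoint m.primeFactors n.primeFactors := hmn.disjoint_primeFactors
    rw [Nat.primeFactors_mul hm0.ne' hn0.ne', card_union_of_disjoint hdisj, prod_union hdisj, pow_add]
    calc quadRootCount α (2 * β) γ (m * n)
        ≤ quadRootCount α (2 * β) γ m * quadRootCount α (2 * β) γ n := quadRootCount_mul_le hm0 hn0 hmn _ _ _
      _ ≤ (4 ^ m.primeFactors.card * ∏ p ∈ m.primeFactors, p ^ (padicValNat p G + padicValNat p E)) *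
          (4 ^ n.primeFactors.card * ∏ p ∈ n.primeFactors, p ^ (padicValNat p G + padicValNat p E)) :=
          Nat.mul_le_mul h1 h2
      _ = _ := by ring

/-- **Corollary**: `ρ(α, 2β, γ; n) ≤ 4^{ω(n)} · G · E` under the same hypotheses. [folklore] -/
theorem quadRootCount_le_of_gcd_of_sq {α β γ : ℤ} (hh : α * γ - β ^ 2 ≠ 0) {G E : ℕ} (hG0 : G ≠ 0)
    (hE0 : E ≠ 0) (hG : (Int.gcd (Int.gcd α β) γ : ℤ) ∣ (G : ℤ))
    (hE : ∀ (p j : ℕ), p.Prime → (p : ℤ) ^ (2 * j) ∣ α * γ - β ^ 2 → p ^ j ∣ E) {n : ℕ} (hn : 0 < n) :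
    quadRootCount α (2 * β) γ n ≤ 4 ^ n.primeFactors.card * G * E := by
  refine (quadRootCount_le_prod hh hG0 hE0 hG hE n hn).trans ?_
  rw [mul_assoc]
  refine Nat.mul_le_mul_left _ ?_
  have hprime : ∀ p ∈ n.primeFactors, p.Prime := fun p hp => Nat.prime_of_mem_primeFactors hp
  calc ∏ p ∈ n.primeFactors, p ^ (padicValNat p G + padicValNat p E)
      = (∏ p ∈ n.primeFactors, p ^ padicValNat p G) * ∏ p ∈ n.primeFactors, p ^ padicValNat p E := by
        rw [← prod_mul_distrib]
        exact prod_congr rfl fun p _ => pow_add _ _ _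
    _ ≤ G * E := Nat.mul_le_mul (Nat.le_of_dvd (Nat.pos_of_ne_zero hG0)
          (prod_pow_padicValNat_dvd G _ hprime))
        (Nat.le_of_dvd (Nat.pos_of_ne_zero hE0) (prod_pow_padicValNat_dvd E _ hprime))

/-! ### Level cosets of a form: the uniform count -/

open RootForms in
/-- **The level cosets of `R = [A, B, C]` at level `q` are at most
`∑_{e ∣ gcd(A, q)} ρ(A/e, B, Ce; q/e)` in number** (`q ≥ 1`).  By the normal form
`RootForms.exists_levelCoset_rep`, every left coset `ξΓ₀(q)` with `q ∣ (R·ξ).a` is the coset of a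
matrix `(u ∗; e ∗)` with `e ∣ gcd(A, q)`, `gcd(u, e) = 1`, `q ∣ Au² + Beu + Ce²`, i.e.
`(q/e) ∣ (A/e)u² + Bu + Ce`; and two such matrices with the same `e` and `u ≡ u' (mod q/e)`
lie in the same coset (`RootForms.mk_eq_mk_iff`: `ue − eu' ≡ 0 (mod q)`).  Hence the cosets
inject into the pairs `(e, u mod q/e)`.  This sharpens the constant of
`RootForms.exists_card_levelCosets_le` (DFI's "`O(τ(q))`", [cite: DukeFriedlanderIwaniec1995, §2 p. 428])
to an explicit one, uniform in the form; with `quadRootCount_le_of_gcd_of_sq` it gives the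
uniformity in `h` needed in [GrimmeltMerikoski2025, §4.1] ("`∑_τ α_q(τ z₂) ≪ gcd(𝔞₂,𝔟₂,𝔠₂,q) d(q)`").
[cite: GrimmeltMerikoski2025, §4.1.1–4.1.2 (the bound for ∑_τ α_q(τ z))] -/
theorem card_levelCosets_le_sum (R : BinQF) {q : ℕ} (hq : 0 < q) :
    Nat.card {x : SL(2, ℤ) ⧸ CongruenceSubgroup.Gamma0 q // IsLevelCoset R q x} ≤
      ∑ e ∈ (Nat.gcd R.a.natAbs q).divisors, quadRootCount (R.a / e) R.b (R.c * e) (q / e) := by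
  classical
  haveI : NeZero q := ⟨hq.ne'⟩
  set D : Finset (Σ _ : ℕ, ℕ) := (Nat.gcd R.a.natAbs q).divisors.sigma (fun e =>
    (range (q / e)).filter (fun u : ℕ => ((q / e : ℕ) : ℤ) ∣ R.a / e * (u : ℤ) ^ 2 + R.b * u + R.c * e))
    with hD
  -- every level coset has a normal-form datum in `D`
  have hrep : ∀ x : {x : SL(2, ℤ) ⧸ CongruenceSubgroup.Gamma0 q // IsLevelCoset R q x},
      ∃ d ∈ D, ∃ (u : ℕ) (g : SL(2, ℤ)), g 0 0 = u ∧ g 1 0 = d.1 ∧ u % (q / d.1) = d.2 ∧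
        (g : SL(2, ℤ) ⧸ CongruenceSubgroup.Gamma0 q) = x.1 := by
    rintro ⟨x, ξ, rfl, hξ⟩
    obtain ⟨e, u, h, heq, heA, _, hroot, hmk⟩ := exists_levelCoset_rep R hq ξ hξ
    refine ⟨⟨e, u % (q / e)⟩, ?_, u, colMatrix u e h, rfl, rfl, rfl, hmk⟩
    have he0 : 0 < e := Nat.pos_of_dvd_of_pos heq hq
    obtain ⟨q', hq'⟩ := heq
    have hq'0 : 0 < q' := by
      rcases Nat.eq_zero_or_pos q' with h0 | h0
      · rw [h0, mul_zero] at hq'; omega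
      · exact h0
    have hqe : q / e = q' := by rw [hq', Nat.mul_div_cancel_left _ he0]
    rw [hD, mem_sigma, Nat.mem_divisors, mem_filter, mem_range]
    refine ⟨⟨Nat.dvd_gcd (Int.natCast_dvd.mp heA) ⟨q', hq'⟩, (Nat.gcd_pos_of_pos_right _ hq).ne'⟩, ?_, ?_⟩
    · rw [hqe]; exact Nat.mod_lt _ hq'0
    · rw [hqe]
      -- `q' ∣ (A/e)u² + Bu + Ce`
      have hAe : (e : ℤ) * (R.a / e) = R.a := Int.mul_ediv_cancel' heA
      have hfac : R.a * (u : ℤ) ^ 2 + R.b * e * u + R.c * e ^ 2 =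
          (e : ℤ) * (R.a / e * (u : ℤ) ^ 2 + R.b * u + R.c * e) := by
        rw [mul_add, mul_add, ← mul_assoc, hAe]; ring
      have hq'dvd : (q' : ℤ) ∣ R.a / e * (u : ℤ) ^ 2 + R.b * u + R.c * e := by
        have h1 : ((e : ℤ) * q') ∣ (e : ℤ) * (R.a / e * (u : ℤ) ^ 2 + R.b * u + R.c * e) := by
          rw [← hfac]; rw [hq'] at hroot; exact_mod_cast hroot
        exact Int.dvd_of_mul_dvd_mul_left (by exact_mod_cast he0.ne') h1
      have hmod : (q' : ℤ) ∣ (u : ℤ) - ((u % q' : ℕ) : ℤ) := by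
        rw [Int.natCast_mod]; exact ⟨(u : ℤ) / q', by rw [Int.emod_def]; ring⟩
      exact (dvd_quad_iff_of_dvd_sub hmod).mp hq'dvd
  choose f hfD hfrep using hrep
  -- the datum determines the coset
  have hinj : Function.Injective (fun x => (⟨f x, hfD x⟩ : D)) := by
    intro x x' hxx'
    have hd : f x = f x' := congrArg Subtype.val hxx'
    have hfx := hfrep x
    have hfx' := hfrep x'
    have hDx := hfD x
    generalize f x = d at hd hfx hDx
    generalize f x' = d' at hd hfx'
    subst hd
    obtain ⟨e, w⟩ := d
    obtain ⟨u, g, hg0, hg1, hu, hmk⟩ := hfx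
    obtain ⟨u', g', hg0', hg1', hu', hmk'⟩ := hfx'
    dsimp only at hg1 hg1' hu hu'
    apply Subtype.ext
    rw [← hmk, ← hmk', mk_eq_mk_iff, hg0, hg1, hg0', hg1']
    -- `u ≡ u' (mod q/e)` hence `q ∣ e(u - u')`
    have hmodeq : u ≡ u' [MOD (q / e)] := by rw [Nat.ModEq, hu, hu']
    have hdvd' : ((q / e : ℕ) : ℤ) ∣ (u' : ℤ) - u := Nat.modEq_iff_dvd.mp hmodeq
    have heq : e ∣ q := by
      rw [hD, mem_sigma, Nat.mem_divisors] at hDx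
      exact hDx.1.1.trans (Nat.gcd_dvd_right _ _)
    have hqe : (q : ℤ) = (e : ℤ) * ((q / e : ℕ) : ℤ) := by
      exact_mod_cast (Nat.mul_div_cancel' heq).symm
    have hdvd : (q : ℤ) ∣ (u : ℤ) * e - e * u' := by
      rw [show (u : ℤ) * e - e * u' = (e : ℤ) * (-((u' : ℤ) - u)) by ring, hqe]
      exact mul_dvd_mul_left _ (dvd_neg.mpr hdvd')
    exact (ZMod.intCast_zmod_eq_zero_iff_dvd _ q).mpr hdvd
  calc Nat.card {x : SL(2, ℤ) ⧸ CongruenceSubgroup.Gamma0 q // IsLevelCoset R q x}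
      ≤ Nat.card D := Nat.card_le_card_of_injective _ hinj
    _ = D.card := Nat.card_eq_finsetCard D
    _ = _ := by rw [hD, card_sigma]; rfl

end GM2025

end Literature.NumberTheory.Sieve

end
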